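import Literature.MathematicalPhysics.QuantumFieldTheory.Balaban1983to89.B9Eq315QFlatSweep

/-!
# `Balaban1983to89.B9Eq3102LeibnizCommutatorAveraging` — T. Bałaban, *Propagators for lattice gauge theories in a background field*, Commun. Math.
# Phys. **99** (1985) 389–434 [Balaban1985BackgroundPropagators] (3.102) p. 414 with (3.15) p. 393 and [Balaban1985Averaging] (125) p. 36: **THE LEIBNIZ
# (PLAIN-COMMUTATOR) LETTERS OF THE FLAT ONE-STEP VECTOR AVERAGING `Q(1)` WITH A SLOWLY VARYING FUNCTION, POINTWISE** — with cutoffs sampled at ONE site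
# per bond, `[h, Q(1)]` IS the sweep mean weighted by the increments `h(π c) − h(x)`, `[h,[h, Q(1)]]` by their SQUARES, the family sum `Σ_j ad_j(ad_j Q(1))`
# by the sweep ENERGY `Σ_j (h_j(π c) − h_j(x))²`; pointwise sizes `≤ ℓ′·L^{−(d+1)}Σ_{sweep}‖f‖`, `Σ_j ‖·‖² ≤ Θ·L^{−(d+1)}Σ_{sweep}‖f‖²`,
# `‖Σ_j […]‖² ≤ Θ²·L^{−(d+1)}Σ_{sweep}‖f‖²` (NO `η`, NO volume, NO fibre constant) — route R2′ STEP B8′ (S-P7 «IMS assembly»), instance-ledger rows L6 ∕ L7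
# of `t4/ROUTES-NE9.md` v13.33 for kernel 7's third local letter `T₃ = √a·Q_U` AT THE FLAT BACKGROUND

statement-level skeleton of published theorems with citation tags; proofs where landed; nothing here is a claim about the Yang–Mills mass gap

CITATION HEADER (lean-in-tree rule).  Audit cell `pub-balaban`, sub-cell `t4`, BINDER row NE9; filed by NE9 formalisation-swarm LEAF PROVER 01
(`b2b-balaban-t4-ne9-formalise-leaf-01`, gen 82), the lineage of the IMS files `B9Eq387QuadraticPartitionIMS` ∕ `B9Eq387IMSAssembly` (kernel 7's port) ∕
`B9Eq387IMSLocalLettersLattice`, as the AVERAGING twin of NE9 leaf-04's `B9Eq3100LeibnizCommutatorCurl ∕ Div ∕ EtaFree` ((3.100): `T₁ = D_U`, `T₂ = D*_U`)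
and the additive twin of NE9 leaf-05's conjugation letter `B9Eq3101ConjugationLetters` §4 (for the SCALAR averaging `Q′` of (3.19)); sequel of
`B9Eq315QFlatSweep` (same seat: the sweep count, the `L²` transfer, `Q(1)` = the sweep mean on the carriers).  Sources READ by this seat in the held text
`paper:balaban1985-cmp99-background-propagators` (journal page = PDF page + 388): p. 393 (3.15), p. 414 (3.101)–(3.103), p. 408.

THE PRINT (verbatim, p. 414).  *«Similarly for averaging operators, if we introduce kernels by the representation (Q_jA)(c) = Σ_{b⊂B^j(c₋)∪B^j(c₊)}
L^{−jd}Q_j(c,b)A(b), then we have (Q_jhA)(c) = h(c₋)(Q_jA)(c) + Σ_b L^{−jd}Q_j(c,b)(∂h)(Γ_{c₋,b₋})A(b) = h(c₋)(Q_jA)(c) + (S_j(∂h)A)(c). (3.102)»*; p. 414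
l. 1–3: the commutators with `h` *«are first order differential operators with coefficients determined by derivatives of the function h. They are of
the order O(M⁻¹), or O(M⁻²), if considered on a proper scale.»*  Print states (3.102) for the `j`-step averaging at a general background through its
kernel; THIS file types the ONE-STEP case at the FLAT background, where the kernel is the explicit uniform weight `L^{−(d+1)}` on the `L^{d+1}` bonds of the
sweep ([B7] (125); `B9Eq315QFlatSweep.QtorusW_one_apply_eq_sum`), the cutoff being sampled at ONE fine site per coarse bond (`π c`; print's `c₋`) and at
`b₋` per fine bond — so `(∂h)(Γ_{c₋,b₋})` becomes the increment `h(π c) − h(b₋)`.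

WHY (route R2′ STEP B8′ «Tier P by discrete IMS localisation», S-P7; instance ledger `t4/ROUTES-NE9.md` v13.33 l. 435–448).  Kernel 7's assembly
`B9Eq387IMSAssembly.ims_assembly_strong` consumes, per local letter `T_i`, the first-order square `a_i : Σ_j ‖ad_jT_ix‖² ≤ a_i‖x‖²` and the PRODUCT
`t_ik_i` of `‖T_i‖` with the double-commutator sum `K_i = Σ_j ad_j(ad_jT_i)` (`ad_jT := χ_E^j∘T − T∘χ_S^j`, (D)'s dress); rows L3∕L4∕L6∕L7 for
`T₁ = D_U`, `T₂ = D*_U` are in the tree (`B9Eq387IMSLocalLettersLattice` §3 over leaf-04's letters); the rows for `i = 3` were ✗ at the instance.  This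
file is their POINTWISE half for `T₃ ∝ Q(1)`; the sequel `B9Eq387IMSAveragingLettersLattice` integrates them along `B9Eq315QFlatSweep`'s transfer.

WHAT IS PROVED (sorry-free; proof lane — no `def`, no `Prop` placeholder; [folklore] Leibniz algebra and Cauchy–Schwarz on landed theorems; nothing of
[B9] asserted).  Setting: `QtorusW … (fun _ => 1) …` under the tree's displayed regularity letters (as `B9Eq315QFlatNorm`); cutoff CLMs `χ_S^j` (fine
1-forms) ∕ `χ_E^j` (coarse 1-forms) ACTING pointwise as the multiplications by `χ_j(b₋)` ∕ `χ_j(π c)` for ONE real family `χ_j` on the fine sites and any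
coarse sampling map `π` (hypotheses `hS`, `hE` — two `rfl`-dischargeable lines for diagonal operators; no operator is defined here, FREEZE e34b3e0c (0)).
* §1 IDENTITIES: **`comm_QtorusW_one_apply`** ((3.102), one step, flat: `(χ_E^jQ(1)f − Q(1)χ_S^jf)(c) = L^{−(d+1)}Σ_{sweep(c)}(χ_j(π c) − χ_j(x))·f(x, κ)`),
  **`comm_comm_QtorusW_one_apply`** (`(χ_E^j(χ_E^jQ(1)f − Q(1)χ_S^jf) − (χ_E^jQ(1)χ_S^jf − Q(1)χ_S^jχ_S^jf))(c)` = the same with SQUARED increments),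
  **`sum_comm_comm_QtorusW_one_apply`** (the family sum over `j ∈ s`: coefficient `Σ_j(χ_j(π c) − χ_j(x))²`, the sweep energy).
* §2 SIZES: `norm_comm_QtorusW_one_apply_le` (`|χ_j(π c) − χ_j(x)| ≤ ℓ′` on the sweep ⟹ `≤ ℓ′·L^{−(d+1)}Σ_{sweep}‖f‖`),
  **`sum_norm_sq_comm_QtorusW_one_apply_le`** (sweep energy `≤ Θ` ⟹ `Σ_j ‖(χ_E^jQ(1)f − Q(1)χ_S^jf)(c)‖² ≤ Θ·L^{−(d+1)}Σ_{sweep}‖f‖²`),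
  **`norm_sq_sum_comm_comm_QtorusW_one_apply_le`** (`‖(Σ_j […])(c)‖² ≤ Θ²·L^{−(d+1)}Σ_{sweep}‖f‖²`).
THE `η`-BOOKKEEPING (words): a sweep has physical extent `≤ 2Lη = 2` blocks at the point `Lη = 1`, so for unit-scale cutoffs `ℓ′ = O(ℓ_χ)`, `Θ = O(Nℓ_χ²)`
carry NO `η` (for the tree's `B5SmoothPartition.hS`: `Θ ≤ 256d(L−1)²∕M₀²`, the sequel's §3); `t₃` is bounded, so nothing needs cancelling in `t₃k₃`.
HONEST SCOPE.  Exact Leibniz algebra and crude counting on the chain's OWN flat averaging; the cutoffs and their two displayed facts (oscillation ∕ energy over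
a sweep) are HYPOTHESES; ONLY `U = 1`; nothing of print's kernel statement (3.102) at a general background, of `S_j(∂h)`'s bounds, or of (3.49)'s decay is
claimed; rows of ONE sub-step of a route step, NOT NE9 (cell pub-balaban: NE9 NOT PRINTED ∕ NOT PROVED; «NE9 ⇐ the named binders»; row WALLED ON A MODEL
(O-NE9-1); spine PROVED 0∕9; rung (B)+1 on a finite T⁴ — NOT infinite volume, NOT mass gap, NOT Clay; HONEST DEPENDENCY: continuum YM on T⁴ ⇐ BetaPertH ∧
nine spine estimates (0/9 proved); BetaPertH ⇐ (D1) ∧ (D4) ∧ CAP+tail; G-an2-4 gates asym, D1 and NE2/3/4).  NEW file importing `B9Eq315QFlatSweep` only;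
nothing modified.  Net new unproved facts: 0.
-/

noncomputable section

open scoped BigOperators InnerProductSpace ComplexConjugate
open Finset

namespace Literature.MathematicalPhysics.QuantumFieldTheory.Balaban1983to89.B9Eq3102LeibnizCommutatorAveraging

open B7Prop1Explicit (U1 Wcx boxVec e)
open B4Sect5Torus (TSite)
open B9SectCLatticeCarrier (Bond bpos)
open B9Eq319QprimeTorus (fineP)
open B9Eq311L2Pairing (WL2)
open B11Eq103H1Complex (BondL2K)
open B9Eq315QTorus (perSite perCfg cornerSite QtorusW)
open B9Eq315QFlatSweep (sq_sweep_mean_le norm_sweep_weight QtorusW_one_apply_eq_sum)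

variable {d : ℕ} (L : ℕ) (m : Fin d → ℕ) [∀ i, NeZero (fineP L m i)] (hL : 1 ≤ L)

/-! ## §1 (3.102) one step, flat: the commutators of `Q(1)` with one-site-sampled cutoffs, pointwise -/

section Flat

variable {𝔸 : Type*} [NormedRing 𝔸] [NormOneClass 𝔸] [NormedAlgebra ℂ 𝔸] [CompleteSpace 𝔸]
  {α' : ℝ} (hα1' : α' ≤ 1 / 64)
  (hU1' : ∀ (x : B7Prop1Explicit.Site d) (κ : Fin d), perCfg (fineP L m) (fun _ : Bond d (fineP L m) => (1 : 𝔸ˣ)) x κ ∈ U1 𝔸)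
  (hreg' : ∀ (y : TSite d m) (κ : Fin d) (r : Fin d → Fin L),
    ‖((Wcx L (perCfg (fineP L m) (fun _ : Bond d (fineP L m) => (1 : 𝔸ˣ))) (cornerSite L y) κ (boxVec L r) : 𝔸ˣ) : 𝔸) - 1‖ ≤ α')
  {W : Type*} [NormedAddCommGroup W] [InnerProductSpace ℂ W] (φ : W ≃ₗ[ℂ] 𝔸) {c₀ c₁ : ℝ}

/-- pure algebra of the commutator with a multiplication under a weighted sum (private helper). [folklore] -/
private theorem comm_alg {ι : Type*} (s₁ : Finset ι) (s₂ : Finset ℕ) (w a : ℂ) (ρ : ι → ℕ → ℂ) (F : ι → ℕ → W) :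
    a • (w • ∑ r ∈ s₁, ∑ i ∈ s₂, F r i) - w • ∑ r ∈ s₁, ∑ i ∈ s₂, ρ r i • F r i =
      w • ∑ r ∈ s₁, ∑ i ∈ s₂, (a - ρ r i) • F r i := by
  rw [smul_comm a w, ← smul_sub, Finset.smul_sum, ← Finset.sum_sub_distrib]
  congr 1
  refine Finset.sum_congr rfl fun r _ => ?_
  rw [Finset.smul_sum, ← Finset.sum_sub_distrib]
  exact Finset.sum_congr rfl fun i _ => by rw [sub_smul]

/-- pure algebra of the double commutator (private helper). [folklore] -/
private theorem comm_comm_alg {ι : Type*} (s₁ : Finset ι) (s₂ : Finset ℕ) (w a : ℂ) (ρ : ι → ℕ → ℂ) (F : ι → ℕ → W) :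
    a • (a • (w • ∑ r ∈ s₁, ∑ i ∈ s₂, F r i) - w • ∑ r ∈ s₁, ∑ i ∈ s₂, ρ r i • F r i) -
        (a • (w • ∑ r ∈ s₁, ∑ i ∈ s₂, ρ r i • F r i) - w • ∑ r ∈ s₁, ∑ i ∈ s₂, ρ r i • ρ r i • F r i) =
      w • ∑ r ∈ s₁, ∑ i ∈ s₂, ((a - ρ r i) ^ 2) • F r i := by
  simp only [Finset.smul_sum, smul_sub, smul_smul, ← Finset.sum_sub_distrib]
  refine Finset.sum_congr rfl fun r _ => Finset.sum_congr rfl fun i _ => ?_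
  simp only [← sub_smul]
  congr 1
  ring

variable [Fact (0 < c₀)] [Fact (0 < c₁)] {J : Type*} (s : Finset J) (πc : Bond d m → TSite d (fineP L m)) (χ : J → TSite d (fineP L m) → ℝ)
  (χS : J → BondL2K ℂ d (fineP L m) c₀ W →L[ℂ] BondL2K ℂ d (fineP L m) c₀ W) (χE : J → BondL2K ℂ d m c₁ W →L[ℂ] BondL2K ℂ d m c₁ W)
  (hS : ∀ j (f : BondL2K ℂ d (fineP L m) c₀ W) (b : Bond d (fineP L m)), WL2.equiv ℂ _ W (χS j f) b = (χ j (bpos b) : ℂ) • WL2.equiv ℂ _ W f b)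
  (hE : ∀ j (g : BondL2K ℂ d m c₁ W) (c : Bond d m), WL2.equiv ℂ _ W (χE j g) c = (χ j (πc c) : ℂ) • WL2.equiv ℂ _ W g c)

include hS hE in
/-- **(3.101) FOR THE FLAT VECTOR AVERAGING, POINTWISE**: for cutoffs acting by ONE-SITE SAMPLING — `χ_S^j` multiplies a fine 1-form at `b` by `χ_j(b₋)`,
`χ_E^j` multiplies a coarse 1-form at `c` by `χ_j(π c)` — the commutator IS the sweep mean weighted by the increments:
`(χ_E^j Q(1)f − Q(1)χ_S^j f)(c) = L^{−(d+1)}·Σ_{sweep(c)} (χ_j(π c) − χ_j(x))·f(x, κ)`. [folklore] (Leibniz rule)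
[cite: Balaban1985BackgroundPropagators, (3.101)–(3.103) p.414, (3.15) p.393; Balaban1985Averaging, (125) p.36] -/
theorem comm_QtorusW_one_apply (j : J) (f : BondL2K ℂ d (fineP L m) c₀ W) (c : Bond d m) :
    WL2.equiv ℂ _ W (χE j (QtorusW L m hL φ (fun _ => 1) hα1' hU1' hreg' (c₁ := c₁) f) -
        QtorusW L m hL φ (fun _ => 1) hα1' hU1' hreg' (c₁ := c₁) (χS j f)) c =
      ((L : ℂ) ^ (d + 1))⁻¹ • ∑ r : Fin d → Fin L, ∑ i ∈ Finset.range L,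
        ((χ j (πc c) - χ j (perSite (fineP L m) (cornerSite L c.1 + boxVec L r + (i : ℤ) • e c.2)) : ℝ) : ℂ) •
          WL2.equiv ℂ _ W f (perSite (fineP L m) (cornerSite L c.1 + boxVec L r + (i : ℤ) • e c.2), c.2) := by
  rw [WL2.equiv_sub, Pi.sub_apply, hE, QtorusW_one_apply_eq_sum L m hL hα1' hU1' hreg', QtorusW_one_apply_eq_sum L m hL hα1' hU1' hreg']
  simp only [hS]
  rw [comm_alg]
  push_cast
  rfl

include hS hE in
/-- **THE DOUBLE COMMUTATOR, POINTWISE**: `(χ_E^j(χ_E^j Q(1)f − Q(1)χ_S^jf) − (χ_E^j Q(1)χ_S^jf − Q(1)χ_S^jχ_S^jf))(c) =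
L^{−(d+1)}·Σ_{sweep(c)} (χ_j(π c) − χ_j(x))²·f(x, κ)` — the SQUARES of the increments ([B9] p. 414 «O(M⁻²) … on a proper scale»). [folklore]
[cite: Balaban1985BackgroundPropagators, (3.101)–(3.103) p.414, (3.15) p.393] -/
theorem comm_comm_QtorusW_one_apply (j : J) (f : BondL2K ℂ d (fineP L m) c₀ W) (c : Bond d m) :
    WL2.equiv ℂ _ W ((χE j (χE j (QtorusW L m hL φ (fun _ => 1) hα1' hU1' hreg' (c₁ := c₁) f) -
        QtorusW L m hL φ (fun _ => 1) hα1' hU1' hreg' (c₁ := c₁) (χS j f))) -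
        (χE j (QtorusW L m hL φ (fun _ => 1) hα1' hU1' hreg' (c₁ := c₁) (χS j f)) -
          QtorusW L m hL φ (fun _ => 1) hα1' hU1' hreg' (c₁ := c₁) (χS j (χS j f)))) c =
      ((L : ℂ) ^ (d + 1))⁻¹ • ∑ r : Fin d → Fin L, ∑ i ∈ Finset.range L,
        (((χ j (πc c) - χ j (perSite (fineP L m) (cornerSite L c.1 + boxVec L r + (i : ℤ) • e c.2))) ^ 2 : ℝ) : ℂ) •
          WL2.equiv ℂ _ W f (perSite (fineP L m) (cornerSite L c.1 + boxVec L r + (i : ℤ) • e c.2), c.2) := by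
  rw [WL2.equiv_sub, Pi.sub_apply, WL2.equiv_sub, Pi.sub_apply, hE, WL2.equiv_sub, Pi.sub_apply, hE, hE,
    QtorusW_one_apply_eq_sum L m hL hα1' hU1' hreg', QtorusW_one_apply_eq_sum L m hL hα1' hU1' hreg',
    QtorusW_one_apply_eq_sum L m hL hα1' hU1' hreg']
  simp only [hS]
  rw [comm_comm_alg]
  push_cast
  rfl

include hS hE in
/-- **THE FAMILY's DOUBLE-COMMUTATOR SUM, POINTWISE** (kernel 7's `K₃ = Σ_j ad_j(ad_j Q(1))` in (D)'s dress):
`(Σ_j […])(c) = L^{−(d+1)}·Σ_{sweep(c)} (Σ_j (χ_j(π c) − χ_j(x))²)·f(x, κ)` — the SWEEP ENERGY of the partition is the coefficient. [folklore]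
[cite: Balaban1985BackgroundPropagators, (3.101)–(3.103) p.414, p.408] -/
theorem sum_comm_comm_QtorusW_one_apply (f : BondL2K ℂ d (fineP L m) c₀ W) (c : Bond d m) :
    WL2.equiv ℂ _ W (∑ j ∈ s, ((χE j (χE j (QtorusW L m hL φ (fun _ => 1) hα1' hU1' hreg' (c₁ := c₁) f) -
        QtorusW L m hL φ (fun _ => 1) hα1' hU1' hreg' (c₁ := c₁) (χS j f))) -
        (χE j (QtorusW L m hL φ (fun _ => 1) hα1' hU1' hreg' (c₁ := c₁) (χS j f)) -
          QtorusW L m hL φ (fun _ => 1) hα1' hU1' hreg' (c₁ := c₁) (χS j (χS j f))))) c =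
      ((L : ℂ) ^ (d + 1))⁻¹ • ∑ r : Fin d → Fin L, ∑ i ∈ Finset.range L,
        ((∑ j ∈ s, (χ j (πc c) - χ j (perSite (fineP L m) (cornerSite L c.1 + boxVec L r + (i : ℤ) • e c.2))) ^ 2 : ℝ) : ℂ) •
          WL2.equiv ℂ _ W f (perSite (fineP L m) (cornerSite L c.1 + boxVec L r + (i : ℤ) • e c.2), c.2) := by
  have e := congrFun (map_sum (WL2.linearEquiv ℂ ℂ (fun _ : Bond d m => c₁) (V := W)) (fun j => (χE j (χE j
      (QtorusW L m hL φ (fun _ => 1) hα1' hU1' hreg' (c₁ := c₁) f) - QtorusW L m hL φ (fun _ => 1) hα1' hU1' hreg' (c₁ := c₁) (χS j f))) -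
        (χE j (QtorusW L m hL φ (fun _ => 1) hα1' hU1' hreg' (c₁ := c₁) (χS j f)) -
          QtorusW L m hL φ (fun _ => 1) hα1' hU1' hreg' (c₁ := c₁) (χS j (χS j f)))) s) c
  simp only [WL2.linearEquiv_apply, Finset.sum_apply] at e
  rw [e]
  simp only [comm_comm_QtorusW_one_apply L m hL hα1' hU1' hreg' φ πc χ χS χE hS hE]
  rw [← Finset.smul_sum]
  congr 1
  rw [Finset.sum_comm]
  refine Finset.sum_congr rfl fun r _ => ?_
  rw [Finset.sum_comm]
  refine Finset.sum_congr rfl fun i _ => ?_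
  rw [← Finset.sum_smul]
  push_cast
  rfl

/-! ## §2 Pointwise sizes by the oscillation `ℓ′` and the sweep energy `Θ` -/

include hS hE in
/-- **POINTWISE SIZE OF THE SINGLE COMMUTATOR**: `|χ_j(π c) − χ_j(x)| ≤ ℓ′` on the sweep of `c` ⟹ `‖(χ_E^jQ(1)f − Q(1)χ_S^jf)(c)‖ ≤ ℓ′·L^{−(d+1)}Σ_{sweep(c)}‖f‖`
— NO `η`, the block pair has bounded physical size at or below `Lη = 1`. [folklore] [cite: Balaban1985BackgroundPropagators, (3.101)–(3.103) p.414, (3.15) p.393] -/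
theorem norm_comm_QtorusW_one_apply_le (j : J) {ℓ' : ℝ}
    (hχ : ∀ (c : Bond d m) (r : Fin d → Fin L) (i : ℕ), i < L →
      |χ j (πc c) - χ j (perSite (fineP L m) (cornerSite L c.1 + boxVec L r + (i : ℤ) • e c.2))| ≤ ℓ')
    (f : BondL2K ℂ d (fineP L m) c₀ W) (c : Bond d m) :
    ‖WL2.equiv ℂ _ W (χE j (QtorusW L m hL φ (fun _ => 1) hα1' hU1' hreg' (c₁ := c₁) f) -
        QtorusW L m hL φ (fun _ => 1) hα1' hU1' hreg' (c₁ := c₁) (χS j f)) c‖ ≤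
      ℓ' * (((L : ℝ) ^ (d + 1))⁻¹ * ∑ r : Fin d → Fin L, ∑ i ∈ Finset.range L,
        ‖WL2.equiv ℂ _ W f (perSite (fineP L m) (cornerSite L c.1 + boxVec L r + (i : ℤ) • e c.2), c.2)‖) := by
  rw [comm_QtorusW_one_apply L m hL hα1' hU1' hreg' φ πc χ χS χE hS hE, norm_smul, norm_sweep_weight]
  have hw0 : (0 : ℝ) ≤ ((L : ℝ) ^ (d + 1))⁻¹ := by positivity
  calc _ ≤ ((L : ℝ) ^ (d + 1))⁻¹ * ∑ r : Fin d → Fin L, ∑ i ∈ Finset.range L,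
        ℓ' * ‖WL2.equiv ℂ _ W f (perSite (fineP L m) (cornerSite L c.1 + boxVec L r + (i : ℤ) • e c.2), c.2)‖ := by
        refine mul_le_mul_of_nonneg_left ((norm_sum_le _ _).trans (Finset.sum_le_sum fun r _ =>
          (norm_sum_le _ _).trans (Finset.sum_le_sum fun i hi => ?_))) hw0
        rw [norm_smul, Complex.norm_real, Real.norm_eq_abs]
        exact mul_le_mul_of_nonneg_right (hχ c r i (Finset.mem_range.1 hi)) (norm_nonneg _)
    _ = _ := by simp only [← Finset.mul_sum]; ring

include hS hE in
/-- **POINTWISE FIRST-ORDER SQUARE OF THE FAMILY** (the `a₃` integrand): sweep energy `Σ_j (χ_j(π c) − χ_j(x))² ≤ Θ` on the sweep of `c` ⟹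
`Σ_j ‖(χ_E^jQ(1)f − Q(1)χ_S^jf)(c)‖² ≤ Θ·L^{−(d+1)}Σ_{sweep(c)}‖f‖²` (Cauchy–Schwarz over the sweep, then the energy). [folklore]
[cite: Balaban1985BackgroundPropagators, (3.101)–(3.103) p.414, p.408] -/
theorem sum_norm_sq_comm_QtorusW_one_apply_le {Θ : ℝ}
    (hΘ : ∀ (c : Bond d m) (r : Fin d → Fin L) (i : ℕ), i < L →
      ∑ j ∈ s, (χ j (πc c) - χ j (perSite (fineP L m) (cornerSite L c.1 + boxVec L r + (i : ℤ) • e c.2))) ^ 2 ≤ Θ)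
    (f : BondL2K ℂ d (fineP L m) c₀ W) (c : Bond d m) :
    ∑ j ∈ s, ‖WL2.equiv ℂ _ W (χE j (QtorusW L m hL φ (fun _ => 1) hα1' hU1' hreg' (c₁ := c₁) f) -
        QtorusW L m hL φ (fun _ => 1) hα1' hU1' hreg' (c₁ := c₁) (χS j f)) c‖ ^ 2 ≤
      Θ * (((L : ℝ) ^ (d + 1))⁻¹ * ∑ r : Fin d → Fin L, ∑ i ∈ Finset.range L,
        ‖WL2.equiv ℂ _ W f (perSite (fineP L m) (cornerSite L c.1 + boxVec L r + (i : ℤ) • e c.2), c.2)‖ ^ 2) := by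
  -- abbreviations: increments `g j r i`, field sizes `a r i`
  set g : J → (Fin d → Fin L) → ℕ → ℝ := fun j r i => χ j (πc c) - χ j (perSite (fineP L m) (cornerSite L c.1 + boxVec L r + (i : ℤ) • e c.2))
    with hg
  set a : (Fin d → Fin L) → ℕ → ℝ := fun r i => ‖WL2.equiv ℂ _ W f (perSite (fineP L m) (cornerSite L c.1 + boxVec L r + (i : ℤ) • e c.2), c.2)‖
    with ha
  have hw0 : (0 : ℝ) ≤ ((L : ℝ) ^ (d + 1))⁻¹ := by positivity
  -- per `j`: the norm is at most the weighted mean of `|g|·a`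
  have hj : ∀ j ∈ s, ‖WL2.equiv ℂ _ W (χE j (QtorusW L m hL φ (fun _ => 1) hα1' hU1' hreg' (c₁ := c₁) f) -
      QtorusW L m hL φ (fun _ => 1) hα1' hU1' hreg' (c₁ := c₁) (χS j f)) c‖ ≤
        ((L : ℝ) ^ (d + 1))⁻¹ * ∑ r : Fin d → Fin L, ∑ i ∈ Finset.range L, |g j r i| * a r i := fun j _ => by
    rw [comm_QtorusW_one_apply L m hL hα1' hU1' hreg' φ πc χ χS χE hS hE, norm_smul, norm_sweep_weight]
    refine mul_le_mul_of_nonneg_left ((norm_sum_le _ _).trans (Finset.sum_le_sum fun r _ =>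
      (norm_sum_le _ _).trans (Finset.sum_le_sum fun i _ => ?_))) hw0
    rw [norm_smul, Complex.norm_real, Real.norm_eq_abs]
  calc ∑ j ∈ s, ‖WL2.equiv ℂ _ W (χE j (QtorusW L m hL φ (fun _ => 1) hα1' hU1' hreg' (c₁ := c₁) f) -
          QtorusW L m hL φ (fun _ => 1) hα1' hU1' hreg' (c₁ := c₁) (χS j f)) c‖ ^ 2
      ≤ ∑ j ∈ s, (((L : ℝ) ^ (d + 1))⁻¹ * ∑ r : Fin d → Fin L, ∑ i ∈ Finset.range L, |g j r i| * a r i) ^ 2 :=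
        Finset.sum_le_sum fun j hj' => pow_le_pow_left₀ (norm_nonneg _) (hj j hj') 2
    _ ≤ ∑ j ∈ s, ((L : ℝ) ^ (d + 1))⁻¹ * ∑ r : Fin d → Fin L, ∑ i ∈ Finset.range L, (|g j r i| * a r i) ^ 2 :=
        Finset.sum_le_sum fun j _ => sq_sweep_mean_le L hL _
    _ = ((L : ℝ) ^ (d + 1))⁻¹ * ∑ r : Fin d → Fin L, ∑ i ∈ Finset.range L, (∑ j ∈ s, g j r i ^ 2) * a r i ^ 2 := by
        rw [← Finset.mul_sum, Finset.sum_comm]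
        congr 1
        refine Finset.sum_congr rfl fun r _ => ?_
        rw [Finset.sum_comm]
        refine Finset.sum_congr rfl fun i _ => ?_
        rw [Finset.sum_mul]
        exact Finset.sum_congr rfl fun j _ => by rw [mul_pow, sq_abs]
    _ ≤ ((L : ℝ) ^ (d + 1))⁻¹ * ∑ r : Fin d → Fin L, ∑ i ∈ Finset.range L, Θ * a r i ^ 2 :=
        mul_le_mul_of_nonneg_left (Finset.sum_le_sum fun r _ => Finset.sum_le_sum fun i hi =>
          mul_le_mul_of_nonneg_right (hΘ c r i (Finset.mem_range.1 hi)) (sq_nonneg _)) hw0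
    _ = Θ * (((L : ℝ) ^ (d + 1))⁻¹ * ∑ r : Fin d → Fin L, ∑ i ∈ Finset.range L, a r i ^ 2) := by
        simp only [← Finset.mul_sum]; ring

include hS hE in
/-- **POINTWISE SIZE OF THE FAMILY's DOUBLE-COMMUTATOR SUM** (the `k₃` integrand): with the sweep energy `≤ Θ`,
`‖(Σ_j […])(c)‖² ≤ Θ²·L^{−(d+1)}Σ_{sweep(c)}‖f‖²`. [folklore] [cite: Balaban1985BackgroundPropagators, (3.101)–(3.103) p.414, p.408] -/
theorem norm_sq_sum_comm_comm_QtorusW_one_apply_le {Θ : ℝ}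
    (hΘ : ∀ (c : Bond d m) (r : Fin d → Fin L) (i : ℕ), i < L →
      ∑ j ∈ s, (χ j (πc c) - χ j (perSite (fineP L m) (cornerSite L c.1 + boxVec L r + (i : ℤ) • e c.2))) ^ 2 ≤ Θ)
    (f : BondL2K ℂ d (fineP L m) c₀ W) (c : Bond d m) :
    ‖WL2.equiv ℂ _ W (∑ j ∈ s, ((χE j (χE j (QtorusW L m hL φ (fun _ => 1) hα1' hU1' hreg' (c₁ := c₁) f) -
        QtorusW L m hL φ (fun _ => 1) hα1' hU1' hreg' (c₁ := c₁) (χS j f))) -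
        (χE j (QtorusW L m hL φ (fun _ => 1) hα1' hU1' hreg' (c₁ := c₁) (χS j f)) -
          QtorusW L m hL φ (fun _ => 1) hα1' hU1' hreg' (c₁ := c₁) (χS j (χS j f))))) c‖ ^ 2 ≤
      Θ ^ 2 * (((L : ℝ) ^ (d + 1))⁻¹ * ∑ r : Fin d → Fin L, ∑ i ∈ Finset.range L,
        ‖WL2.equiv ℂ _ W f (perSite (fineP L m) (cornerSite L c.1 + boxVec L r + (i : ℤ) • e c.2), c.2)‖ ^ 2) := by
  set a : (Fin d → Fin L) → ℕ → ℝ := fun r i => ‖WL2.equiv ℂ _ W f (perSite (fineP L m) (cornerSite L c.1 + boxVec L r + (i : ℤ) • e c.2), c.2)‖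
    with ha
  have hw0 : (0 : ℝ) ≤ ((L : ℝ) ^ (d + 1))⁻¹ := by positivity
  have h1 : ‖WL2.equiv ℂ _ W (∑ j ∈ s, ((χE j (χE j (QtorusW L m hL φ (fun _ => 1) hα1' hU1' hreg' (c₁ := c₁) f) -
        QtorusW L m hL φ (fun _ => 1) hα1' hU1' hreg' (c₁ := c₁) (χS j f))) -
        (χE j (QtorusW L m hL φ (fun _ => 1) hα1' hU1' hreg' (c₁ := c₁) (χS j f)) -
          QtorusW L m hL φ (fun _ => 1) hα1' hU1' hreg' (c₁ := c₁) (χS j (χS j f))))) c‖ ≤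
      ((L : ℝ) ^ (d + 1))⁻¹ * ∑ r : Fin d → Fin L, ∑ i ∈ Finset.range L, Θ * a r i := by
    rw [sum_comm_comm_QtorusW_one_apply L m hL hα1' hU1' hreg' φ s πc χ χS χE hS hE, norm_smul, norm_sweep_weight]
    refine mul_le_mul_of_nonneg_left ((norm_sum_le _ _).trans (Finset.sum_le_sum fun r _ =>
      (norm_sum_le _ _).trans (Finset.sum_le_sum fun i hi => ?_))) hw0
    rw [norm_smul, Complex.norm_real, Real.norm_eq_abs, abs_of_nonneg (Finset.sum_nonneg fun j _ => sq_nonneg _)]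
    exact mul_le_mul_of_nonneg_right (hΘ c r i (Finset.mem_range.1 hi)) (norm_nonneg _)
  calc _ ≤ (((L : ℝ) ^ (d + 1))⁻¹ * ∑ r : Fin d → Fin L, ∑ i ∈ Finset.range L, Θ * a r i) ^ 2 := pow_le_pow_left₀ (norm_nonneg _) h1 2
    _ ≤ ((L : ℝ) ^ (d + 1))⁻¹ * ∑ r : Fin d → Fin L, ∑ i ∈ Finset.range L, (Θ * a r i) ^ 2 := sq_sweep_mean_le L hL _
    _ = Θ ^ 2 * (((L : ℝ) ^ (d + 1))⁻¹ * ∑ r : Fin d → Fin L, ∑ i ∈ Finset.range L, a r i ^ 2) := by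
        simp only [mul_pow, ← Finset.mul_sum]; ring

end Flat


end Literature.MathematicalPhysics.QuantumFieldTheory.Balaban1983to89.B9Eq3102LeibnizCommutatorAveraging

end
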